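import Summits.ResolutionOfSingularities.ResolutionOfSingularities.Theorems.WeightedInvariantWeightedThesisGlobalCobordantPlus
import Summits.ResolutionOfSingularities.ResolutionOfSingularities.Theorems.WeightedInvariantDatumToEmbeddedStrictTransform
import Summits.ResolutionOfSingularities.ResolutionOfSingularities.Theorems.WeightedInvariantDatumToEmbeddedExceptional
import Summits.ResolutionOfSingularities.ResolutionOfSingularities.Theorems.WeightedInvariantDatumToEmbeddedLift
import HarnessLib

/-!
# The cobordant tower for an arbitrary regular weighted centre — ambient, strict transform, exceptional identity, lift

Support for crux `stmt-ResolutionOfSingularities-0569`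
(`Summit.ResolutionOfSingularities.ResolutionOfSingularities.Theses.WeightedInvariant.WeightedThesis`),
line `datum-glued-split`, RESHAPE 7 (lead c7). The tower of crux `DatumToEmbedded` (stmt-0572,
`Theorems/WeightedInvariantDatumToEmbedded*.lean`) is written for a weighted resolution datum
`D : WeightedResolutionDatum p`, but its step lemmas use the datum only NOMINALLY: through the Rees
algebra `D.centre f X`, the fact that it is a regular weighted centre (axiom `(iii)`), and the fact that
the generic point of the integral `X` is off its support (axioms `(ii)`/`(iii)`). This file restates the
DATUM-FREE content of four step lemmas for an ARBITRARY regular weighted centre `R` on `Y` and a Rees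
filtration `R'` with the pieces of `R` (proofs verbatim, the datum's axioms replaced by the hypotheses
`hc : R.IsRegularWeightedCentre` and `hξ : i (genericPoint X) ∉ R.support`), so that the tower can be
re-run for the hypersurface datum of RESHAPE 7 (`Theorems/…HypersurfaceDatum.lean`) — and for any
future variant of the interface — without touching the landed files:

* `GlobalCobordantPlus.smooth_πPlus_comp_of_isRegularWeightedCentre` — `B₊ → Y → Spec k` is smooth,
  separated and quasi-compact (from `stub_smooth_globalCobordantPlus`);
* `StrictTransform.isIntegral_strictTransformPlus_of_not_mem_support` — the strict transform of the
  integral `X` is integral and lies over `X` (from `stub_strictTransform`);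
* `Exceptional.exists_veroneseExceptional_of_isRegularWeightedCentre` — a Veronese piece of the
  centre is a power of the exceptional ideal on `B₊` (from `stub_qs_exceptional`);
* `Lift.nonempty_preimage_basicOpen_of_not_mem_support`, `Lift.qs_lift_of_not_mem_support`
  (registered stub) — the strict transform meets `B₋`, and maps to the blow-up downstairs (from
  `nonempty_preimage_basicOpen`, `stub_qs_lift`).
-/

noncomputable section

open scoped LaurentPolynomial
open LaurentPolynomial CategoryTheory CategoryTheory.Limits AlgebraicGeometry TopologicalSpace
open Literature.AlgebraicGeometry.Resolution
open Summit.ResolutionOfSingularities.ResolutionOfSingularities.Theorems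

set_option linter.dupNamespace false -- mandated namespace `…Theorems.<Topic>`

/-! ## The new ambient -/

namespace Summit.ResolutionOfSingularities.ResolutionOfSingularities.Theorems.WeightedThesis.GlobalCobordantPlus

/-- **Over a perfect field, the global cobordant blow-up of a regular weighted centre is again a
smooth separated quasi-compact ambient** (datum-free form of `stub_smooth_globalCobordantPlus`): for
`f : Y → Spec k` smooth separated quasi-compact over a perfect field, a regular weighted centre `R` on
`Y` and a Rees filtration `R'` with the pieces of `R`, the structure map `σ₊ ≫ f : B₊ → Y → Spec k` of
`B₊ = Spec_Y(⊕ₙ 𝒥ₙ tⁿ) ∖ Vert` is smooth (`B` regular, Włodarczyk §2.3.9, and locally of finite type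
over the perfect field), separated and quasi-compact. [cite: Wlodarczyk2022, §2.3.9 and Def. 5.1.1] -/
theorem smooth_πPlus_comp_of_isRegularWeightedCentre {k : Type} [Field k] [PerfectField k]
    {Y : Scheme.{0}} (f : Y ⟶ Spec (.of k)) [Smooth f] [IsSeparated f] [QuasiCompact f]
    (R : ReesAlgebraData Y) (hc : R.IsRegularWeightedCentre) (R' : ReesFiltration Y)
    (hR' : R'.ideal = R.piece) :
    Smooth (R'.πPlus ≫ f) ∧ IsSeparated (R'.πPlus ≫ f) ∧ QuasiCompact (R'.πPlus ≫ f) := by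
  haveI : IsLocallyNoetherian Y := LocallyOfFiniteType.isLocallyNoetherian f
  have hY : Scheme.IsRegular Y := Scheme.IsRegular.of_smooth f (Scheme.isRegular_Spec (.of k))
  haveI : LocallyOfFiniteType R'.π := locallyOfFiniteType_π R R' hR' hc
  haveI : IsLocallyNoetherian R'.cobordantBlowup := LocallyOfFiniteType.isLocallyNoetherian R'.π
  have hBplus : Scheme.IsRegular (R'.plus : Scheme.{0}) :=
    isRegular_plus R' (isRegular_cobordantBlowup R R' hR' hY hc)
  haveI : LocallyOfFiniteType (R'.πPlus ≫ f) := by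
    show LocallyOfFiniteType ((R'.plus.ι ≫ R'.π) ≫ f)
    infer_instance
  haveI : IsSeparated (R'.πPlus ≫ f) := by
    show IsSeparated ((R'.plus.ι ≫ R'.π) ≫ f)
    infer_instance
  haveI : QuasiCompact (R'.πPlus ≫ f) := by
    show QuasiCompact ((R'.plus.ι ≫ R'.π) ≫ f)
    infer_instance
  exact ⟨smooth_of_isRegular_of_perfectField _ hBplus, inferInstance, inferInstance⟩

end Summit.ResolutionOfSingularities.ResolutionOfSingularities.Theorems.WeightedThesis.GlobalCobordantPlus

/-! ## The strict transform of the integral `X` -/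

namespace Summit.ResolutionOfSingularities.ResolutionOfSingularities.Theorems.DatumToEmbedded.StrictTransform

/-- The generic point of `X`, off the support of `R`, is off the support of some positive piece of a
Rees filtration with the pieces of `R`. [folklore] -/
theorem exists_genericPoint_not_mem_support {Y X : Scheme.{0}} (i : X ⟶ Y) [IsIntegral X]
    (R : ReesAlgebraData Y) (R' : ReesFiltration Y) (hR' : R'.ideal = R.piece)
    (hξ : i (genericPoint X) ∉ R.support) :
    ∃ n : ℕ, 0 < n ∧ i (genericPoint X) ∉ (R'.ideal n).support := by
  by_contra hcon
  push Not at hcon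
  exact hξ ((ReesAlgebraData.mem_support_iff _).mpr fun n hn => hR' ▸ hcon n hn)

/-- **The strict transform of an integral closed subscheme off the centre is integral** (datum-free
form of `stub_strictTransform`): for a closed immersion `i : X ⟶ Y` of an INTEGRAL `X` into a locally
Noetherian `Y`, a regular weighted centre `R` on `Y` whose support misses the generic point of `X`, and
a Rees filtration `R'` with the pieces of `R`, the strict transform `X' = V(σˢ(ker i)|_{B₊})` on the
global cobordant blow-up `B₊ = R'.plus` is an integral scheme and `ker i ⊆ ker (X' ⟶ B₊ ⟶ Y)`.
[cite: Wlodarczyk2022, 3.3.12] -/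
theorem isIntegral_strictTransformPlus_of_not_mem_support {Y X : Scheme.{0}} [IsLocallyNoetherian Y]
    (i : X ⟶ Y) [IsClosedImmersion i] [IsIntegral X]
    (R : ReesAlgebraData Y) (hc : R.IsRegularWeightedCentre) (R' : ReesFiltration Y)
    (hR' : R'.ideal = R.piece) (hξ : i (genericPoint X) ∉ R.support) :
    IsIntegral (R'.strictTransformPlus i.ker).subscheme ∧
      i.ker ≤ ((R'.strictTransformPlus i.ker).subschemeι ≫ R'.πPlus).ker := by
  refine ⟨?_, le_ker_subschemeι_comp_πPlus R' i.ker⟩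
  haveI : LocallyOfFiniteType R'.π :=
    WeightedThesis.GlobalCobordantPlus.locallyOfFiniteType_π R R' hR' hc
  haveI : IsLocallyNoetherian R'.cobordantBlowup := LocallyOfFiniteType.isLocallyNoetherian R'.π
  have hξY : i (genericPoint X) ∈ i.ker.support := i.range_subset_ker_support ⟨_, rfl⟩
  have hξ' := exists_genericPoint_not_mem_support i R R' hR' hξ
  exact isIntegral_subscheme_iSup_colon_comap_ι R'.π R'.toA1 R'
    (fun U => R'.openCover.f ⟨U.1, U.2⟩) (hφ := fun U => R'.openCover.map_prop ⟨U.1, U.2⟩)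
    (fun U => R'.ι_π ⟨U.1, U.2⟩)
    (fun U => R'.ι_toA1 ⟨U.1, U.2⟩) (fun U => (R'.π_preimage ⟨U.1, U.2⟩).symm) i.ker
    (fun y hy U hyU => isPrime_ker_ideal i hy U hyU) (isPreirreducible_support_ker i) R'.plus
    (fun U => R'.image_plusChart_le_plus ⟨U.1, U.2⟩) hξY hξ'

end Summit.ResolutionOfSingularities.ResolutionOfSingularities.Theorems.DatumToEmbedded.StrictTransform

/-! ## The exceptional identity -/

namespace Summit.ResolutionOfSingularities.ResolutionOfSingularities.Theorems.DatumToEmbedded.Exceptional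

-- `R'.plus.ι ⁻¹ᵁ _` versus `Opens.map` inside `rw` motives on the glued scheme (as in the source file):
set_option backward.isDefEq.respectTransparency false in
/-- **On `B₊` a Veronese piece of a regular weighted centre is a power of the exceptional ideal**
(datum-free form of `stub_qs_exceptional`): for a quasi-compact `Y`, a regular weighted centre `R` and
a Rees filtration `R'` with the pieces of `R`, there is `N₀ > 0` (the product of the weights of finitely
many weighted charts covering `Y`) such that `J_Dg · 𝒪_{B₊} = (t⁻¹)^Dg` for every multiple `Dg` of
`N₀` (Włodarczyk, Lemma 2.3.8). [cite: Wlodarczyk2022, Lemma 2.3.8] -/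
theorem exists_veroneseExceptional_of_isRegularWeightedCentre {Y : Scheme.{0}} [CompactSpace Y]
    (R : ReesAlgebraData Y) (hc : R.IsRegularWeightedCentre) (R' : ReesFiltration Y)
    (hR' : R'.ideal = R.piece) :
    ∃ N₀ : ℕ, 0 < N₀ ∧ ∀ Dg : ℕ, N₀ ∣ Dg → (R.piece Dg).comap R'.πPlus = R'.excPlus ^ Dg := by
  -- finitely many weighted charts of the regular weighted centre cover the quasi-compact `Y`
  choose U hyU m u w hchart using hc
  obtain ⟨t, ht⟩ : ∃ t : Finset Y, ∀ y : Y, ∃ y₀ ∈ t, y ∈ (U y₀ : Y.Opens) := by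
    obtain ⟨t, ht⟩ := isCompact_univ.elim_finite_subcover (fun y₀ : Y => ((U y₀ : Y.Opens) : Set Y))
      (fun y₀ => (U y₀ : Y.Opens).2) (fun y _ => Set.mem_iUnion.mpr ⟨y, hyU y⟩)
    refine ⟨t, fun y => ?_⟩
    simpa only [Set.mem_iUnion, exists_prop, SetLike.mem_coe] using ht (Set.mem_univ y)
  refine ⟨∏ y₀ ∈ t, ∏ i, w y₀ i,
    Finset.prod_pos fun y₀ _ => Finset.prod_pos fun i _ => (hchart y₀).w_pos i, fun Dg hDg => ?_⟩
  have hmon : ∀ (y₀ : Y) (n : ℕ), (R'.ideal n).ideal (U y₀) =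
      Ideal.span (weightedMonomials (u y₀) (w y₀) n) := fun y₀ n => by
    rw [hR', (hchart y₀).ideal_eq n, weightedMonomialIdeal_eq_span_weightedMonomials]
  exact comap_πPlus_eq_excPlus_pow R' (fun y₀ : t => U y₀)
    (fun y => let ⟨y₀, hy₀, hy⟩ := ht y; ⟨⟨y₀, hy₀⟩, hy⟩) (fun y₀ => u y₀) (fun y₀ => w y₀)
    (fun y₀ => (hchart y₀).w_pos) (fun y₀ => hmon y₀) (R.piece Dg)
    (fun y₀ => by rw [(hchart _).ideal_eq Dg, weightedMonomialIdeal_eq_span_weightedMonomials])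
    fun y₀ i => ((Finset.dvd_prod_of_mem (w y₀) (Finset.mem_univ i)).trans
      (Finset.dvd_prod_of_mem (fun y₁ => ∏ i, w y₁ i) y₀.2)).trans hDg

end Summit.ResolutionOfSingularities.ResolutionOfSingularities.Theorems.DatumToEmbedded.Exceptional

/-! ## The strict transform meets `B₋` and maps to the blow-up downstairs -/

namespace Summit.ResolutionOfSingularities.ResolutionOfSingularities.Theorems.DatumToEmbedded.Lift

/-- **The strict transform meets `B₋ = {t⁻¹ ≠ 0}`** (datum-free form of
`nonempty_preimage_basicOpen`): for a closed immersion `i : X ⟶ Y` of an integral `X` into a locally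
Noetherian `Y`, a regular weighted centre `R` whose support misses the generic point of `X`, and the
Rees filtration `R'` with the pieces of `R`, the preimage of `𝔸¹ ∖ 0` under
`t⁻¹ : X' = V(R'.strictTransformPlus (ker i)) ⟶ B₊ ⟶ B ⟶ 𝔸¹` is non-empty.
[cite: Wlodarczyk2022, 3.3.12] -/
theorem nonempty_preimage_basicOpen_of_not_mem_support {Y X : Scheme.{0}} [IsLocallyNoetherian Y]
    (i : X ⟶ Y) [IsClosedImmersion i] [IsIntegral X]
    (R : ReesAlgebraData Y) (hc : R.IsRegularWeightedCentre) (R' : ReesFiltration Y)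
    (hR' : R'.ideal = R.piece) (hξ : i (genericPoint X) ∉ R.support) :
    ((((R'.strictTransformPlus i.ker).subschemeι ≫ R'.plus.ι ≫ R'.toA1) ⁻¹ᵁ
      PrimeSpectrum.basicOpen (Polynomial.X : Polynomial ReesFiltration.ZZ.{0}) :
        (R'.strictTransformPlus i.ker).subscheme.Opens) :
          Set (R'.strictTransformPlus i.ker).subscheme).Nonempty := by
  haveI : LocallyOfFiniteType R'.π := WeightedThesis.GlobalCobordantPlus.locallyOfFiniteType_π
    R R' hR' hc
  haveI : IsLocallyNoetherian R'.cobordantBlowup := LocallyOfFiniteType.isLocallyNoetherian R'.π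
  -- the generic point of `X` lies in `X` and off the centre
  have hξY : i (genericPoint X) ∈ i.ker.support := i.range_subset_ker_support ⟨_, rfl⟩
  have hξ' := StrictTransform.exists_genericPoint_not_mem_support i R R' hR' hξ
  -- an affine neighbourhood `U₀` of the generic point: `(ker i)(U₀)` is prime and its
  -- saturation misses the irrelevant ideal
  obtain ⟨U₀, hU₀, hξU₀, -⟩ :=
    exists_isAffineOpen_mem_and_subset (X := Y) (x := i (genericPoint X)) (U := ⊤) trivial
  haveI : (i.ker.ideal ⟨U₀, hU₀⟩).IsPrime :=
    StrictTransform.isPrime_ker_ideal i hξY ⟨U₀, hU₀⟩ hξU₀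
  have hirrel : ¬ (R'.filtration ⟨U₀, hU₀⟩).irrelevant ≤ ⨆ n : ℕ,
      ((i.ker.ideal ⟨U₀, hU₀⟩).map (algebraMap Γ(Y, U₀) (R'.sectionsRing ⟨U₀, hU₀⟩))).colon
        ((Ideal.span {(⟨T (-1), (R'.filtration ⟨U₀, hU₀⟩).T_neg_one_mem_extendedRees⟩ :
          R'.sectionsRing ⟨U₀, hU₀⟩)} ^ n : Ideal (R'.sectionsRing ⟨U₀, hU₀⟩)) :
            Set (R'.sectionsRing ⟨U₀, hU₀⟩)) := by
    intro h
    obtain ⟨n, hn, hξn⟩ := hξ'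
    have hle := StrictTransform.ideal_le_of_irrelevant_le R' ⟨U₀, hU₀⟩ i.ker h hn
    apply hξn
    rw [Scheme.IdealSheafData.mem_support_iff_of_mem (U := ⟨U₀, hU₀⟩) hξU₀,
      Scheme.mem_zeroLocus_iff]
    intro a ha
    have hK := (Scheme.IdealSheafData.mem_support_iff_of_mem (U := ⟨U₀, hU₀⟩) hξU₀).mp hξY
    rw [Scheme.mem_zeroLocus_iff] at hK
    exact hK a (hle ha)
  -- the point of `B₊ ∩ supp σˢ(ker i) ∩ B₋` over `U₀`, lifted to `X'`
  obtain ⟨b, hbO, hb, hbτ⟩ := exists_mem_support_basicOpen R'.π R'.toA1 R' ⟨U₀, hU₀⟩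
    (R'.openCover.f ⟨U₀, hU₀⟩) (hφ := R'.openCover.map_prop ⟨U₀, hU₀⟩) (R'.ι_π ⟨U₀, hU₀⟩)
    (R'.ι_toA1 ⟨U₀, hU₀⟩) i.ker R'.plus (R'.image_plusChart_le_plus ⟨U₀, hU₀⟩) hirrel
  exact nonempty_preimage_subschemeι (R'.strictTransform i.ker) R'.plus R'.toA1 _ hbO hb hbτ

/-- **The strict transform maps to the blow-up downstairs** (datum-free form of `stub_qs_lift`,
registered stub of line `datum-glued-split`, RESHAPE 7): with `R`, `R'`, `i` as above and
`q : X ⟶ V` quasi-compact, if the downstairs centre `K = ker (V(J_{Dg}·𝒪_X) ⟶ X ⟶ V)` pulls back to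
the `Dg`-th power of the exceptional ideal on the integral strict transform `X'`, then `K ≠ ⊥` and
every blow-up `ρ : V' ⟶ V` along `K` receives `q' : X' ⟶ V'` with `q' ≫ ρ = σX ≫ q` (universal
property of the blow-up against the effective Cartier divisor `K·𝒪_{X'} = E^{Dg}`).
[cite: Wlodarczyk2022, §2.3.3] -/
theorem qs_lift_of_not_mem_support : ∀ {Y X V : AlgebraicGeometry.Scheme.{0}} [AlgebraicGeometry.IsLocallyNoetherian Y] (i : X ⟶ Y) [AlgebraicGeometry.IsClosedImmersion i] [AlgebraicGeometry.IsIntegral X] (q : X ⟶ V) [AlgebraicGeometry.QuasiCompact q] (R : Literature.AlgebraicGeometry.Resolution.ReesAlgebraData Y), R.IsRegularWeightedCentre → ∀ (R' : Literature.AlgebraicGeometry.Resolution.ReesFiltration Y), R'.ideal = R.piece → i (genericPoint X) ∉ R.support → ∀ [AlgebraicGeometry.IsIntegral (R'.strictTransformPlus i.ker).subscheme] (σX : (R'.strictTransformPlus i.ker).subscheme ⟶ X), σX ≫ i = (R'.strictTransformPlus i.ker).subschemeι ≫ R'.πPlus → ∀ (Dg : ℕ), 0 < Dg → ((((R.piece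 Dg).comap i).subschemeι ≫ q).ker).comap (σX ≫ q) = (R'.excPlus.comap (R'.strictTransformPlus i.ker).subschemeι) ^ Dg → (((R.piece Dg).comap i).subschemeι ≫ q).ker ≠ ⊥ ∧ ∀ (V' : AlgebraicGeometry.Scheme.{0}) (ρ : V' ⟶ V), Literature.AlgebraicGeometry.Resolution.IsBlowup ρ (((R.piece Dg).comap i).subschemeι ≫ q).ker → ∃ q' : (R'.strictTransformPlus i.ker).subscheme ⟶ V', q' ≫ ρ = σX ≫ q := by
  intro Y X V _ i _ _ q _ R hc R' hR' hξ _ σX _ Dg _ hA3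
  -- the exceptional ideal on `X'` is `τ^*(x)` for the coordinate `τ = t⁻¹ : X' ⟶ B₊ ⟶ B ⟶ 𝔸¹`
  have hEeq : R'.excPlus.comap (R'.strictTransformPlus i.ker).subschemeι =
      (affineBlowup.idealSheaf (Ideal.span {Polynomial.X})).comap
        ((R'.strictTransformPlus i.ker).subschemeι ≫ R'.plus.ι ≫ R'.toA1) := by
    rw [Scheme.IdealSheafData.comap_comp, Scheme.IdealSheafData.comap_comp]
    rfl
  -- `K · 𝒪_{X'} = E^{Dg}` is an effective Cartier divisor
  have hcart : IsEffectiveCartier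
      (((((R.piece Dg).comap i).subschemeι ≫ q).ker).comap (σX ≫ q)) := by
    rw [hA3, hEeq]
    exact isEffectiveCartier_comap_pow _
      (nonempty_preimage_basicOpen_of_not_mem_support i R hc R' hR' hξ) Dg
  refine ⟨fun hK => ?_, fun V' ρ hρ => ⟨hρ.lift (σX ≫ q) hcart, hρ.lift_comp _ _⟩⟩
  rw [hK, Scheme.IdealSheafData.comap_bot] at hcart
  exact ne_bot_of_isEffectiveCartier hcart rfl

end Summit.ResolutionOfSingularities.ResolutionOfSingularities.Theorems.DatumToEmbedded.Lift

end
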